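import Summits.Parity.GeneralizedHardyLittlewood.Theorems.GreenTaoLevelTwoGITwoCyclicInverseBohrSize

/-!
# Route `GreenTaoLevelTwo`, crux `GITwo` (stmt-Parity-21275), line `birth`, stub `stub_cyclicInverse`:
# the symmetry bound for the halved frequency map (GT08a arXiv Lemma 46 ⇒ §9 Step 3 input)

Fiftieth helper file toward the XL stub `stub_cyclicInverse` (B. Green, T. Tao, *An inverse theorem
for the Gowers `U³(G)` norm*, arXiv:math/0503014, Thm. 68 = PEMS 51 (2008) Thm. 12.8).
`symmetry_of_derivative` (`…Symmetry`) bounds the form `{x,z}_μ = μ(x)·z − μ(z)·x` of the doubled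
map `μ = 2M`; §9 Step 3 uses the form of `M` itself (`two_mul_pair_eq`).  With `N` odd and
`M := c·μ`, `2c = 1` (`…Halving`), `{x,z}_M = {x',z}_μ` for `x = 2x'`, and `‖x'·ξ‖ = ‖x·(cξ)‖`: so the
`μ`-bound at level `t` for `x'` measured against `S` gives the `M`-bound at level `t` for `x`
measured against `S₃ = c·S` — the paper's "`S₃ = ½·S`, `B₃ = 2·B'₃`".  Def-free, hypotheses abstract:

* `symmetry_half` — from `∀ t x', (‖x'ξ‖ ≤ t ∀ ξ ∈ S) → P x' → ‖{x',z}_μ‖ ≤ C t` and local additivity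
  `μ(x'+x') = μ x' + μ x'` for such `x'`, deduce `‖{x,z}_{cμ}‖ ≤ C t` for all `x` with
  `‖x·(cξ)‖ ≤ t` (`ξ ∈ S`).

References: [GreenTao2008U3Inverse] arXiv:math/0503014, Lemma 46 (end of proof), §9 Step 3.
-/

namespace Summit.Parity.GeneralizedHardyLittlewood.GreenTaoLevelTwoGITwoCyclicInverse

variable {N : ℕ} [NeZero N]

/-- **Symmetry bound for the halved map.**  Let `2c = 1` in `ℤ/Nℤ`, `μ : ℤ/Nℤ → ℤ/Nℤ`, `t > 0`,
`z ∈ ℤ/Nℤ`, and suppose: (i) every `x'` with `‖x'ξ‖ ≤ t` for all `ξ ∈ S` satisfies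
`‖toAddCircle(μ(x')z) − toAddCircle(μ(z)x')‖ ≤ K` and `μ(x'+x') = μ x' + μ x'`.  Then every `x` with
`‖x·(cξ)‖ ≤ t` for all `ξ ∈ S` satisfies `‖toAddCircle(cμ(x)·z) − toAddCircle(cμ(z)·x)‖ ≤ K`.
[cite: GreenTao2008U3Inverse, Lemma 46 (proof, "`{2x,z} = 2{x,z}`")] -/
theorem symmetry_half (S : Finset (ZMod N)) {c : ZMod N} (hc : 2 * c = 1) (μ : ZMod N → ZMod N)
    {t K : ℝ} (z : ZMod N)
    (hsym : ∀ x' : ZMod N, (∀ ξ ∈ S, ‖ZMod.toAddCircle (x' * ξ)‖ ≤ t) →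
      ‖ZMod.toAddCircle (μ x' * z) - ZMod.toAddCircle (μ z * x')‖ ≤ K)
    (hadd : ∀ x' : ZMod N, (∀ ξ ∈ S, ‖ZMod.toAddCircle (x' * ξ)‖ ≤ t) → μ (x' + x') = μ x' + μ x')
    {x : ZMod N} (hx : ∀ ξ ∈ S, ‖ZMod.toAddCircle (x * (c * ξ))‖ ≤ t) :
    ‖ZMod.toAddCircle (c * μ x * z) - ZMod.toAddCircle (c * μ z * x)‖ ≤ K := by
  -- `x = 2x'` with `x' = c x`
  set x' : ZMod N := c * x with hx'
  have hx'S : ∀ ξ ∈ S, ‖ZMod.toAddCircle (x' * ξ)‖ ≤ t := fun ξ hξ => by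
    rw [hx', show c * x * ξ = x * (c * ξ) by ring]; exact hx ξ hξ
  have hxx : x = x' + x' := by
    rw [hx']
    calc x = (2 * c) * x := by rw [hc, one_mul]
      _ = c * x + c * x := by ring
  have hμ := hadd x' hx'S
  have key : c * μ x * z - c * μ z * x = μ x' * z - μ z * x' := by
    rw [hxx, hμ]
    have h2 : μ x' + μ x' = 2 * μ x' := by ring
    have h3 : x' + x' = 2 * x' := by ring
    rw [h2, h3]
    calc c * (2 * μ x') * z - c * μ z * (2 * x') = (2 * c) * (μ x' * z - μ z * x') := by ring
      _ = μ x' * z - μ z * x' := by rw [hc, one_mul]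
  rw [← map_sub, key, map_sub]
  exact hsym x' hx'S

end Summit.Parity.GeneralizedHardyLittlewood.GreenTaoLevelTwoGITwoCyclicInverse
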